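import Literature.NumberTheory.DiophantineGeometry.GLHighestWeight
import HarnessLib

/-!
# REVIEW-RUNBOOK sanity lemmas — `hwMultiplicity` is a genuine dimension on finite-dimensional representations
# (client `pub-gct` of the ops review-runbook generator; §2 card `hwMultiplicity`)

`Literature.NumberTheory.DiophantineGeometry.hwMultiplicity ρ χ = Module.finrank k (highestWeightSpace ρ χ)`, the
dimension of the space of highest-weight vectors of weight `χ` in a representation `ρ` of `GL σ k` on `V`.  Mathlib's
`Module.finrank` is the default `0` when that space is not finite-dimensional (the docstring of `hwMultiplicity` says so:
«Junk value `0` if the highest-weight space is infinite-dimensional»).  The definition's `V` is an ARBITRARY `k`-module, so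
the side fact is argument-dependent: it holds exactly as the statements use it — on a finite-dimensional `V` — and this
file records it under that (instance) hypothesis, together with the bound `hwMultiplicity ρ χ ≤ dim V` it yields.

Review evidence only (topic module, closes no item); no definitions, no `sorry`, standard axioms.
-/

namespace Summit.PneNP.GCT.Runbook

open Literature.NumberTheory.DiophantineGeometry

/-- (c) **On a finite-dimensional representation the highest-weight space is finite-dimensional** (a subspace of `V`):
under `[FiniteDimensional k V]` the `Module.finrank` defining `hwMultiplicity ρ χ` is the genuine multiplicity.
[folklore] -/
theorem hwMultiplicity_space_finite {σ k V : Type*} [Fintype σ] [LinearOrder σ] [Field k] [AddCommGroup V]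
    [Module k V] [FiniteDimensional k V] (ρ : Representation k (GL σ k) V) (χ : Weight σ) :
    Module.Finite k (highestWeightSpace ρ χ) :=
  inferInstance

/-- The same fact spelled `FiniteDimensional`. [folklore] -/
theorem hwMultiplicity_space_finiteDimensional {σ k V : Type*} [Fintype σ] [LinearOrder σ] [Field k]
    [AddCommGroup V] [Module k V] [FiniteDimensional k V] (ρ : Representation k (GL σ k) V) (χ : Weight σ) :
    FiniteDimensional k (highestWeightSpace ρ χ) :=
  inferInstance

/-- Hence `hwMultiplicity ρ χ ≤ dim_k V` on a finite-dimensional `V`. [folklore] -/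
theorem hwMultiplicity_le_finrank {σ k V : Type*} [Fintype σ] [LinearOrder σ] [Field k] [AddCommGroup V]
    [Module k V] [FiniteDimensional k V] (ρ : Representation k (GL σ k) V) (χ : Weight σ) :
    hwMultiplicity ρ χ ≤ Module.finrank k V :=
  Submodule.finrank_le _

end Summit.PneNP.GCT.Runbook
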